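import Mathlib
import HarnessLib
import Summits.NavierStokesRegularity.NavierStokesRegularity.Theorems.ChiralWindowDoorDefs
import Summits.NavierStokesRegularity.NavierStokesRegularity.Theorems.CriticalFluxDoorDefs
import Summits.NavierStokesRegularity.NavierStokesRegularity.Theorems.ChiralWindowDoorBinderFree
import Summits.NavierStokesRegularity.NavierStokesRegularity.Theorems.ChiralWindowDoorSobolevFatouOfClass
import Summits.NavierStokesRegularity.NavierStokesRegularity.Theorems.CriticalFluxDoorCritEnergyLower
import Summits.NavierStokesRegularity.NavierStokesRegularity.Theorems.CriticalFluxDoorFluxSpread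
import Summits.NavierStokesRegularity.NavierStokesRegularity.Theorems.CriticalFluxDoorLocalPointZoomFluxWindow

/-!
# Door S21-C «CriticalFluxDoor» (nsreg-p1 ROUND-20, design-only) — the residue, K2 and the door `Target` FROM THE TWO
# REMAINING STUBS F2 `stub_critDissipationLower` and F3 `stub_critEnergyBudget` (everything else a tree theorem)

Door S21-C of nsreg-p1's local Type-I door family (`HOME/ns-regularity-ideate-p1/ROUND-20.md`, texts `r20/Sketch21v3.lean`;
DESIGN-ONLY, route NOT born).  The planner's compositions `FluxFreeProfileRigidityEverywhere_of_F` (residue ⇐ F1…F5),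
`FluxFreeProfileRigidity_of_stubs` (K2 ⇐ residue + spread) and `closes` (Target ⇐ K1 ∧ K2), re-run with tree theorems
in every slot except F2 and F3:

* F1 = `…CriticalFluxDoorCritEnergyLower.critEnergyLower` (nsreg-p1 g18), F4 = `…SobolevFatouOfClass.sobolevFatou_of_class_noBinder`
  (CLASS form — the binder-free F4 text is not provable as printed), F5 = `…BinderFree.essLocalClass_of_class`,
  spread = `…CriticalFluxDoorFluxSpread.fluxSpread_of_class`, K1 = `…LocalPointZoomFluxWindow.localPointZoomFluxWindow`;
* `fluxFreeProfileRigidityEverywhere_of_F2_F3` — support `FluxFreeProfileRigidityEverywhere` (text verbatim) FROM F2, F3;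
* `fluxFreeProfileRigidity_of_F2_F3` — crux K2 `FluxFreeProfileRigidity` (text verbatim) FROM F2, F3;
* `target_of_F2_F3` — **the door `Target` (text verbatim) FROM the texts of F2 and F3 alone**: S21-C = door modulo its
  windowed `Ḣ^{1/2}` budget.

Seat nsreg-p6 g12 (THEOREMS-ONLY door sequels, DIRECTOR-NS g8 #32 (2)/#36); texts by nsreg-p1 g17/g18.  WHAT THIS IS
NOT: not NS regularity (Clay A); F2/F3 are NOT proved here (conditional compositions); no route is opened.
-/

noncomputable section

-- the summit and its single sub-problem share the name (CONVENTIONS §1), as in every Theorems file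
set_option linter.dupNamespace false

namespace Summit.NavierStokesRegularity.NavierStokesRegularity.Theorems.CriticalFluxDoorTargetOfF2F3

open MeasureTheory Set Function Filter Topology Metric
open scoped RealInnerProductSpace NNReal ENNReal
open Literature.Analysis Literature.Analysis.FluidPDE
open Summit.NavierStokesRegularity.NavierStokesRegularity.Theorems.ChiralWindowDoorDefs
open Summit.NavierStokesRegularity.NavierStokesRegularity.Theorems.CriticalFluxDoorDefs
open Summit.NavierStokesRegularity.NavierStokesRegularity.Theorems.ChiralWindowDoorBinderFree (essLocalClass_of_class)
open Summit.NavierStokesRegularity.NavierStokesRegularity.Theorems.ChiralWindowDoorSobolevFatouOfClass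
  (sobolevFatou_of_class_noBinder)
open Summit.NavierStokesRegularity.NavierStokesRegularity.Theorems.CriticalFluxDoorCritEnergyLower (critEnergyLower)
open Summit.NavierStokesRegularity.NavierStokesRegularity.Theorems.CriticalFluxDoorFluxSpread (fluxSpread_of_class)
open Summit.NavierStokesRegularity.NavierStokesRegularity.Theorems.CriticalFluxDoorLocalPointZoomFluxWindow
  (localPointZoomFluxWindow)

/-- **Support `FluxFreeProfileRigidityEverywhere` of `r20/Sketch21v3.lean` (text verbatim) FROM the texts of F2 and F3**
(F1, F4 (class form), F5 are tree theorems; bookkeeping `G(a_R, v t₀) ≤ c₁ + 2c₂ + c₃` with `linarith`). -/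
theorem fluxFreeProfileRigidityEverywhere_of_F2_F3
    (hF2 : ∀ (η : EuclideanSpace ℝ (Fin 3) → ℝ), IsAdmissibleBump η → ∀ (C D : ℝ)
      (v : ℝ → EuclideanSpace ℝ (Fin 3) → EuclideanSpace ℝ (Fin 3)),
      HasTypeITimeDecay C v → HasTypeIDecay D v →
      ContinuousOn (Function.uncurry v) (Set.Iio (0 : ℝ) ×ˢ Set.univ) →
      (∀ s t : ℝ, s < t → t < 0 → ∀ x,
          v t x = UnboundedOperators.heatExtension (v s) (t - s) x - oseenDuhamel 1 s v v t x) →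
      (∀ t < 0, VectorCalculus.IsDivFree (v t)) →
      ∃ c : ℝ, ∀ R > (0 : ℝ), ∀ t₀ < (0 : ℝ),
        ∑ i : Fin 3, ∫ t in Set.Iio t₀, gagliardo (bumpSq η R) (pderiv i (v t)) ≤
          (∑ i : Fin 3, ∫ t in Set.Iio t₀, critEnergy (bumpSq η R) (pderiv i (v t))) + c)
    (hF3 : ∀ (η : EuclideanSpace ℝ (Fin 3) → ℝ), IsAdmissibleBump η → ∀ (C D : ℝ)
      (v : ℝ → EuclideanSpace ℝ (Fin 3) → EuclideanSpace ℝ (Fin 3)),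
      HasTypeITimeDecay C v → HasTypeIDecay D v →
      ContinuousOn (Function.uncurry v) (Set.Iio (0 : ℝ) ×ˢ Set.univ) →
      (∀ s t : ℝ, s < t → t < 0 → ∀ x,
          v t x = UnboundedOperators.heatExtension (v s) (t - s) x - oseenDuhamel 1 s v v t x) →
      (∀ t < 0, VectorCalculus.IsDivFree (v t)) →
      (∀ t < 0, IsFluxFree (v t)) →
      ∃ c : ℝ, ∀ R > (0 : ℝ), ∀ t₀ < (0 : ℝ),
        critEnergy (bumpSq η R) (v t₀) + 2 * ∑ i : Fin 3, ∫ t in Set.Iio t₀, critEnergy (bumpSq η R) (pderiv i (v t)) ≤ c) :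
    ∀ (C D : ℝ) (v : ℝ → EuclideanSpace ℝ (Fin 3) → EuclideanSpace ℝ (Fin 3)), Literature.Analysis.FluidPDE.HasTypeITimeDecay C v → Literature.Analysis.FluidPDE.HasTypeIDecay D v → ContinuousOn (Function.uncurry v) (Set.Iio (0 : ℝ) ×ˢ Set.univ) → (∀ s t : ℝ, s < t → t < 0 → ∀ x, v t x = Literature.Analysis.UnboundedOperators.heatExtension (v s) (t - s) x - Literature.Analysis.FluidPDE.oseenDuhamel 1 s v v t x) → (∀ t < 0, Literature.Analysis.FluidPDE.VectorCalculus.IsDivFree (v t)) → (∀ t < 0, IsFluxFree (v t)) → ¬ Literature.Analysis.FluidPDE.IsBackwardSingularPoint v 0 := by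
  intro C D v hrate hdecay hcont hmild hdiv hff
  obtain ⟨η, hη⟩ := exists_admissibleBump
  obtain ⟨c₁, h₁⟩ := critEnergyLower η hη C D v hrate hdecay hcont hmild hdiv
  obtain ⟨c₂, h₂⟩ := hF2 η hη C D v hrate hdecay hcont hmild hdiv
  obtain ⟨c₃, h₃⟩ := hF3 η hη C D v hrate hdecay hcont hmild hdiv hff
  have hGbound : ∃ c : ℝ, ∀ R > (0 : ℝ), ∀ t₀ < (0 : ℝ), gagliardo (bumpSq η R) (v t₀) ≤ c := by
    refine ⟨c₁ + 2 * c₂ + c₃, fun R hR t₀ ht₀ => ?_⟩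
    have e₁ := h₁ R hR t₀ ht₀
    have e₂ := h₂ R hR t₀ ht₀
    have e₃ := h₃ R hR t₀ ht₀
    rw [← critEnergy_eq] at e₁
    have hnn : 0 ≤ ∑ i : Fin 3, ∫ t in Set.Iio t₀, gagliardo (bumpSq η R) (pderiv i (v t)) :=
      Finset.sum_nonneg fun i _ =>
        setIntegral_nonneg measurableSet_Iio fun t _ => gagliardo_nonneg (bumpSq_nonneg η R) _
    linarith
  have hL3 := sobolevFatou_of_class_noBinder η hη C D v hrate hdecay hcont hmild hdiv hGbound
  exact essLocalClass_of_class hrate hdecay hcont hmild hdiv hL3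

/-- **Crux K2 `FluxFreeProfileRigidity` of `r20/Sketch21v3.lean` (text verbatim) FROM F2 and F3** (spread is a tree theorem). -/
theorem fluxFreeProfileRigidity_of_F2_F3
    (hF2 : ∀ (η : EuclideanSpace ℝ (Fin 3) → ℝ), IsAdmissibleBump η → ∀ (C D : ℝ)
      (v : ℝ → EuclideanSpace ℝ (Fin 3) → EuclideanSpace ℝ (Fin 3)),
      HasTypeITimeDecay C v → HasTypeIDecay D v →
      ContinuousOn (Function.uncurry v) (Set.Iio (0 : ℝ) ×ˢ Set.univ) →
      (∀ s t : ℝ, s < t → t < 0 → ∀ x,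
          v t x = UnboundedOperators.heatExtension (v s) (t - s) x - oseenDuhamel 1 s v v t x) →
      (∀ t < 0, VectorCalculus.IsDivFree (v t)) →
      ∃ c : ℝ, ∀ R > (0 : ℝ), ∀ t₀ < (0 : ℝ),
        ∑ i : Fin 3, ∫ t in Set.Iio t₀, gagliardo (bumpSq η R) (pderiv i (v t)) ≤
          (∑ i : Fin 3, ∫ t in Set.Iio t₀, critEnergy (bumpSq η R) (pderiv i (v t))) + c)
    (hF3 : ∀ (η : EuclideanSpace ℝ (Fin 3) → ℝ), IsAdmissibleBump η → ∀ (C D : ℝ)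
      (v : ℝ → EuclideanSpace ℝ (Fin 3) → EuclideanSpace ℝ (Fin 3)),
      HasTypeITimeDecay C v → HasTypeIDecay D v →
      ContinuousOn (Function.uncurry v) (Set.Iio (0 : ℝ) ×ˢ Set.univ) →
      (∀ s t : ℝ, s < t → t < 0 → ∀ x,
          v t x = UnboundedOperators.heatExtension (v s) (t - s) x - oseenDuhamel 1 s v v t x) →
      (∀ t < 0, VectorCalculus.IsDivFree (v t)) →
      (∀ t < 0, IsFluxFree (v t)) →
      ∃ c : ℝ, ∀ R > (0 : ℝ), ∀ t₀ < (0 : ℝ),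
        critEnergy (bumpSq η R) (v t₀) + 2 * ∑ i : Fin 3, ∫ t in Set.Iio t₀, critEnergy (bumpSq η R) (pderiv i (v t)) ≤ c) :
    ∀ (C D : ℝ) (v : ℝ → EuclideanSpace ℝ (Fin 3) → EuclideanSpace ℝ (Fin 3)), Literature.Analysis.FluidPDE.HasTypeITimeDecay C v → Literature.Analysis.FluidPDE.HasTypeIDecay D v → ContinuousOn (Function.uncurry v) (Set.Iio (0 : ℝ) ×ˢ Set.univ) → (∀ s t : ℝ, s < t → t < 0 → ∀ x, v t x = Literature.Analysis.UnboundedOperators.heatExtension (v s) (t - s) x - Literature.Analysis.FluidPDE.oseenDuhamel 1 s v v t x) → (∀ t < 0, Literature.Analysis.FluidPDE.VectorCalculus.IsDivFree (v t)) → (∀ s < 0, ∃ U : Set (EuclideanSpace ℝ (Fin 3)), IsOpen U ∧ U.Nonempty ∧ ∀ z ∈ U, fluxDensity (v s) z = 0) → ¬ Literature.Analysis.FluidPDE.IsBackwardSingularPoint v 0 := by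
  intro C D v hrate hdecay hcont hmild hdiv hwin
  refine fluxFreeProfileRigidityEverywhere_of_F2_F3 hF2 hF3 C D v hrate hdecay hcont hmild hdiv fun t ht => ?_
  rw [isFluxFree_iff]
  refine fluxSpread_of_class C D v hrate hdecay hcont hmild hdiv (fun s hs => ?_) t ht
  obtain ⟨U, hU, hne, hz⟩ := hwin s hs
  exact ⟨U, hU, hne, fun z hzU => by rw [← fluxDensity_eq]; exact hz z hzU⟩

/-- **The door `Target` of `r20/Sketch21v3.lean` (text verbatim) FROM THE TEXTS OF F2 AND F3 ALONE** (K1 is a tree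
theorem; the planner's `closes`). -/
theorem target_of_F2_F3
    (hF2 : ∀ (η : EuclideanSpace ℝ (Fin 3) → ℝ), IsAdmissibleBump η → ∀ (C D : ℝ)
      (v : ℝ → EuclideanSpace ℝ (Fin 3) → EuclideanSpace ℝ (Fin 3)),
      HasTypeITimeDecay C v → HasTypeIDecay D v →
      ContinuousOn (Function.uncurry v) (Set.Iio (0 : ℝ) ×ˢ Set.univ) →
      (∀ s t : ℝ, s < t → t < 0 → ∀ x,
          v t x = UnboundedOperators.heatExtension (v s) (t - s) x - oseenDuhamel 1 s v v t x) →
      (∀ t < 0, VectorCalculus.IsDivFree (v t)) →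
      ∃ c : ℝ, ∀ R > (0 : ℝ), ∀ t₀ < (0 : ℝ),
        ∑ i : Fin 3, ∫ t in Set.Iio t₀, gagliardo (bumpSq η R) (pderiv i (v t)) ≤
          (∑ i : Fin 3, ∫ t in Set.Iio t₀, critEnergy (bumpSq η R) (pderiv i (v t))) + c)
    (hF3 : ∀ (η : EuclideanSpace ℝ (Fin 3) → ℝ), IsAdmissibleBump η → ∀ (C D : ℝ)
      (v : ℝ → EuclideanSpace ℝ (Fin 3) → EuclideanSpace ℝ (Fin 3)),
      HasTypeITimeDecay C v → HasTypeIDecay D v →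
      ContinuousOn (Function.uncurry v) (Set.Iio (0 : ℝ) ×ˢ Set.univ) →
      (∀ s t : ℝ, s < t → t < 0 → ∀ x,
          v t x = UnboundedOperators.heatExtension (v s) (t - s) x - oseenDuhamel 1 s v v t x) →
      (∀ t < 0, VectorCalculus.IsDivFree (v t)) →
      (∀ t < 0, IsFluxFree (v t)) →
      ∃ c : ℝ, ∀ R > (0 : ℝ), ∀ t₀ < (0 : ℝ),
        critEnergy (bumpSq η R) (v t₀) + 2 * ∑ i : Fin 3, ∫ t in Set.Iio t₀, critEnergy (bumpSq η R) (pderiv i (v t)) ≤ c) :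
    ∀ (ν T : ℝ), 0 < ν → 0 < T → ∀ (u : ℝ → EuclideanSpace ℝ (Fin 3) → EuclideanSpace ℝ (Fin 3)) (p : ℝ → EuclideanSpace ℝ (Fin 3) → ℝ), Literature.Analysis.FluidPDE.IsClassicalNSSolutionOn (Set.Ico 0 T) ν 0 u p → Literature.Analysis.FluidPDE.IsLerayHopfOn T ν 0 (u 0) u → Literature.Analysis.FluidPDE.HasRapidSpatialDecay (u 0) → ∀ (x₀ : EuclideanSpace ℝ (Fin 3)) (ρ M : ℝ), 0 < ρ → (∀ t ∈ Set.Ico 0 T, T - ρ ^ 2 < t → ∀ x ∈ Metric.ball x₀ ρ, ‖u t x‖ * (‖x - x₀‖ + Real.sqrt (ν * (T - t))) ≤ M) → ∀ (U : Set (EuclideanSpace ℝ (Fin 3))), IsOpen U → U.Nonempty → Filter.Tendsto (fun t => ∫⁻ y in U, ENNReal.ofReal (Real.sqrt (T - t) ^ 5 * |fluxDensity (u t) (x₀ + Real.sqrt (T - t) • y)|)) (nhdsWithin T (Set.Iio T)) (nhds 0) → Literature.Analysis.FluidPDE.IsBackwardBoundedAt u T x₀ := by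
  intro ν T hν hT u p hcl hLH hdec x₀ ρ M hρ hM U hU hUne hfade
  by_contra hnot
  obtain ⟨C, D, v, hrate, hdecay, hcont, hmild, hdiv, hsing, hwin⟩ :=
    localPointZoomFluxWindow ν T hν hT u p hcl hLH hdec x₀ ρ M hρ hM U hU hUne hfade hnot
  exact fluxFreeProfileRigidity_of_F2_F3 hF2 hF3 C D v hrate hdecay hcont hmild hdiv hwin hsing

end Summit.NavierStokesRegularity.NavierStokesRegularity.Theorems.CriticalFluxDoorTargetOfF2F3

end
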